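import Mathlib
import HarnessLib

/-!
# Monotone fibre density — `stub_monotoneFibreDensity` (stub REG-loc)
of line `swap-odd-threshold-rigidity`
(crux `EmbeddedDrudeMourre.MourreDissolution`, item stmt-AtomisticToContinuum-12594; helper file, `--supports`)

Registered stub REG-loc of the checked skeleton of line `swap-odd-threshold-rigidity` (lead c9),
in the skeleton's stub namespace
`Summit.AtomisticToContinuum.FouriersLaw.Theorems.MourreDissolution`.

**Statement.** Let `Ω : ℝ × ℝ × ℝ → ℝ` be `C¹` with `∂₁Ω = fderiv ℝ Ω p (1,0,0) ≥ c > 0` on the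
closed box `[a₁,b₁] × [a₂,b₂] × [a₃,b₃]` and let `G ≥ 0` be continuous with topological support in
the open box. Then `Measure.map Ω (vol.withDensity G) = vol.withDensity ρ` for a *continuous*
`ρ ≥ 0` on `ℝ` (the monotone-fibre half of the coarea formula in one box and one direction).

**Proof** (Mathlib only). For `k` in the transversal box `Q = [a₂,b₂] × [a₃,b₃]` the fibre map
`t ↦ Ω (t, k)` has derivative `∂₁Ω ≥ c` (chain rule), so `c (t' − t) ≤ Ω (t', k) − Ω (t, k)` on
`[a₁,b₁]` (mean value theorem): injective and bi-Lipschitz. A clamped inverse `h k E ∈ [a₁,b₁]`,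
`Ω (h k E, P k) = max (Ω (a₁,P k)) (min E (Ω (b₁,P k)))` (`P` = clamp onto `Q`; IVT + choice),
is jointly continuous since
`c |h x − h x₀| ≤ |clamp x − clamp x₀| + |Ω (h x₀, P k₀) − Ω (h x₀, P k)|`. The fibre density
`Φ k E = G (h k E, k) / ∂₁Ω (h k E, P k)` is continuous, `≥ 0`, and vanishes unless `k ∈ int Q` and
`E` is in the open fibre range; `ρ E = ∫ k in Q, Φ k E` is continuous
(`continuous_parametric_integral_of_continuous`). The measure identity is checked on `lintegral`s
(`Measure.ext_of_lintegral`): Tonelli on `ℝ × (ℝ × ℝ)`, the 1-D change of variables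
`lintegral_image_eq_lintegral_abs_deriv_mul` on each fibre (`|∂₁Ω| · Φ ∘ Ω = G`), Tonelli back.
Degenerate boxes force `G = 0`, where `ρ = 0` works. All auxiliaries (`P`, `h`, `Φ`) enter the
helper lemmas as variables with characterising hypotheses (`hP`, `hh`, `hΦ`); no definitions.
-/

noncomputable section

namespace Summit.AtomisticToContinuum.FouriersLaw.Theorems.MourreDissolution

open MeasureTheory Filter Set Function Topology
open scoped ENNReal NNReal Topology

variable {Ω G : ℝ × ℝ × ℝ → ℝ} {a₁ b₁ a₂ b₂ a₃ b₃ c : ℝ} {P : ℝ × ℝ → ℝ × ℝ} {h Φ : ℝ × ℝ → ℝ → ℝ}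

/-- A function vanishes outside any set containing its topological support. [folklore] -/
theorem monoFibre_eq_zero_of_notMem {U : Set (ℝ × ℝ × ℝ)} (hG : tsupport G ⊆ U)
    {p : ℝ × ℝ × ℝ} (hp : p ∉ U) : G p = 0 :=
  Function.notMem_support.1 fun h => hp (hG (subset_tsupport _ h))

/-! ### The fibre maps `t ↦ Ω (t, k)` -/

/-- Chain rule along the first coordinate line: the derivative of `t ↦ Ω (t, k)` at `t` is the
partial derivative `fderiv ℝ Ω (t, k) (1, 0, 0)`. [folklore] -/
theorem monoFibre_hasDerivAt (hΩ : ContDiff ℝ 1 Ω) (k : ℝ × ℝ) (t : ℝ) :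
    HasDerivAt (fun s => Ω (s, k)) (fderiv ℝ Ω (t, k) (1, 0, 0)) t := by
  have h1 : HasDerivAt (fun s : ℝ => (s, k)) ((1 : ℝ), (0 : ℝ × ℝ)) t :=
    (hasDerivAt_id t).prodMk (hasDerivAt_const t k)
  exact ((hΩ.differentiable one_ne_zero) (t, k)).hasFDerivAt.comp_hasDerivAt t h1

/-- Mean value inequality on a fibre: `c ≤ ∂₁Ω` on the closed box gives
`c (t' − t) ≤ Ω (t', k) − Ω (t, k)` for `t ≤ t'` in `[a₁, b₁]`, `k` in the transversal box.
[folklore] -/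
theorem monoFibre_mul_sub_le (hΩ : ContDiff ℝ 1 Ω)
    (hd : ∀ p ∈ Icc a₁ b₁ ×ˢ (Icc a₂ b₂ ×ˢ Icc a₃ b₃), c ≤ fderiv ℝ Ω p (1, 0, 0)) {k : ℝ × ℝ}
    (hk : k ∈ Icc a₂ b₂ ×ˢ Icc a₃ b₃) {t t' : ℝ} (ht : t ∈ Icc a₁ b₁) (ht' : t' ∈ Icc a₁ b₁)
    (htt' : t ≤ t') : c * (t' - t) ≤ Ω (t', k) - Ω (t, k) := by
  have hder := monoFibre_hasDerivAt hΩ k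
  refine (convex_Icc a₁ b₁).mul_sub_le_image_sub_of_le_deriv
    (fun s _ => (hder s).continuousAt.continuousWithinAt)
    (fun s _ => (hder s).differentiableAt.differentiableWithinAt) (fun s hs => ?_) t ht t' ht' htt'
  rw [(hder s).deriv]
  exact hd (s, k) ⟨Ioo_subset_Icc_self (interior_Icc (a := a₁) ▸ hs), hk⟩

/-- Bi-Lipschitz lower bound on a fibre: `c |t' − t| ≤ |Ω (t', k) − Ω (t, k)|`. [folklore] -/
theorem monoFibre_mul_abs_sub_le (hΩ : ContDiff ℝ 1 Ω)
    (hd : ∀ p ∈ Icc a₁ b₁ ×ˢ (Icc a₂ b₂ ×ˢ Icc a₃ b₃), c ≤ fderiv ℝ Ω p (1, 0, 0)) {k : ℝ × ℝ}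
    (hk : k ∈ Icc a₂ b₂ ×ˢ Icc a₃ b₃) {t t' : ℝ} (ht : t ∈ Icc a₁ b₁) (ht' : t' ∈ Icc a₁ b₁) :
    c * |t' - t| ≤ |Ω (t', k) - Ω (t, k)| := by
  rcases le_total t t' with h | h
  · rw [abs_of_nonneg (sub_nonneg.2 h)]
    exact (monoFibre_mul_sub_le hΩ hd hk ht ht' h).trans (le_abs_self _)
  · rw [abs_of_nonpos (sub_nonpos.2 h), neg_sub, abs_sub_comm]
    exact (monoFibre_mul_sub_le hΩ hd hk ht' ht h).trans (le_abs_self _)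

/-- Monotonicity of the fibre map on `[a₁, b₁]`. [folklore] -/
theorem monoFibre_le (hΩ : ContDiff ℝ 1 Ω)
    (hd : ∀ p ∈ Icc a₁ b₁ ×ˢ (Icc a₂ b₂ ×ˢ Icc a₃ b₃), c ≤ fderiv ℝ Ω p (1, 0, 0)) (hc : 0 < c)
    {k : ℝ × ℝ} (hk : k ∈ Icc a₂ b₂ ×ˢ Icc a₃ b₃) {t t' : ℝ} (ht : t ∈ Icc a₁ b₁)
    (ht' : t' ∈ Icc a₁ b₁) (htt' : t ≤ t') : Ω (t, k) ≤ Ω (t', k) :=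
  sub_nonneg.1 ((mul_nonneg hc.le (sub_nonneg.2 htt')).trans
    (monoFibre_mul_sub_le hΩ hd hk ht ht' htt'))

/-- Injectivity of the fibre map on `[a₁, b₁]`. [folklore] -/
theorem monoFibre_injOn (hΩ : ContDiff ℝ 1 Ω)
    (hd : ∀ p ∈ Icc a₁ b₁ ×ˢ (Icc a₂ b₂ ×ˢ Icc a₃ b₃), c ≤ fderiv ℝ Ω p (1, 0, 0)) (hc : 0 < c)
    {k : ℝ × ℝ} (hk : k ∈ Icc a₂ b₂ ×ˢ Icc a₃ b₃) : InjOn (fun s => Ω (s, k)) (Icc a₁ b₁) := by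
  intro t ht t' ht' h
  have key := monoFibre_mul_abs_sub_le hΩ hd hk ht ht'
  rw [show Ω (t', k) = Ω (t, k) from h.symm, sub_self, abs_zero] at key
  exact (sub_eq_zero.1 (abs_nonpos_iff.1 (by nlinarith [abs_nonneg (t' - t)]))).symm

/-! ### The clamped fibre inverse `h` (relative to a clamp `P` onto the transversal box) -/

/-- Existence of a clamped fibre inverse: for every `k, E` a point `h k E ∈ [a₁, b₁]` with
`Ω (h k E, P k) = max (Ω (a₁, P k)) (min E (Ω (b₁, P k)))` (intermediate value theorem).
[folklore] -/
theorem monoFibre_exists_inv (hΩ : ContDiff ℝ 1 Ω)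
    (hd : ∀ p ∈ Icc a₁ b₁ ×ˢ (Icc a₂ b₂ ×ˢ Icc a₃ b₃), c ≤ fderiv ℝ Ω p (1, 0, 0)) (hc : 0 < c)
    (h₁ : a₁ ≤ b₁) (hP : ∀ k, P k ∈ Icc a₂ b₂ ×ˢ Icc a₃ b₃) :
    ∃ h : ℝ × ℝ → ℝ → ℝ, ∀ k E,
      h k E ∈ Icc a₁ b₁ ∧ Ω (h k E, P k) = max (Ω (a₁, P k)) (min E (Ω (b₁, P k))) := by
  have H : ∀ (k : ℝ × ℝ) (E : ℝ),
      ∃ t ∈ Icc a₁ b₁, Ω (t, P k) = max (Ω (a₁, P k)) (min E (Ω (b₁, P k))) := by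
    intro k E
    have hab : Ω (a₁, P k) ≤ Ω (b₁, P k) :=
      monoFibre_le hΩ hd hc (hP k) (left_mem_Icc.2 h₁) (right_mem_Icc.2 h₁) h₁
    have hcont : ContinuousOn (fun s => Ω (s, P k)) (Icc a₁ b₁) :=
      fun s _ => (monoFibre_hasDerivAt hΩ _ s).continuousAt.continuousWithinAt
    obtain ⟨t, ht, hteq⟩ :=
      intermediate_value_Icc h₁ hcont ⟨le_max_left _ _, max_le hab (min_le_right _ _)⟩
    exact ⟨t, ht, hteq⟩
  choose h hh using H
  exact ⟨h, hh⟩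

/-- A clamped inverse is a left inverse of the fibre map on `[a₁, b₁]`. [folklore] -/
theorem monoFibre_inv_apply (hΩ : ContDiff ℝ 1 Ω)
    (hd : ∀ p ∈ Icc a₁ b₁ ×ˢ (Icc a₂ b₂ ×ˢ Icc a₃ b₃), c ≤ fderiv ℝ Ω p (1, 0, 0)) (hc : 0 < c)
    (hP : ∀ k, P k ∈ Icc a₂ b₂ ×ˢ Icc a₃ b₃)
    (hh : ∀ k E, h k E ∈ Icc a₁ b₁ ∧ Ω (h k E, P k) = max (Ω (a₁, P k)) (min E (Ω (b₁, P k))))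
    (k : ℝ × ℝ) {t : ℝ} (ht : t ∈ Icc a₁ b₁) : h k (Ω (t, P k)) = t := by
  obtain ⟨hmem, heq⟩ := hh k (Ω (t, P k))
  have h₁ : a₁ ≤ b₁ := ht.1.trans ht.2
  rw [min_eq_left (monoFibre_le hΩ hd hc (hP k) ht (right_mem_Icc.2 h₁) ht.2),
    max_eq_right (monoFibre_le hΩ hd hc (hP k) (left_mem_Icc.2 h₁) ht ht.1)] at heq
  exact monoFibre_injOn hΩ hd hc (hP k) hmem ht heq

/-- Joint continuity of a clamped fibre inverse in `(k, E)` (for a continuous clamp `P`).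
[folklore] -/
theorem monoFibre_continuous_inv (hΩ : ContDiff ℝ 1 Ω)
    (hd : ∀ p ∈ Icc a₁ b₁ ×ˢ (Icc a₂ b₂ ×ˢ Icc a₃ b₃), c ≤ fderiv ℝ Ω p (1, 0, 0)) (hc : 0 < c)
    (hP : ∀ k, P k ∈ Icc a₂ b₂ ×ˢ Icc a₃ b₃) (hPc : Continuous P)
    (hh : ∀ k E, h k E ∈ Icc a₁ b₁ ∧ Ω (h k E, P k) = max (Ω (a₁, P k)) (min E (Ω (b₁, P k)))) :
    Continuous fun x : (ℝ × ℝ) × ℝ => h x.1 x.2 := by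
  have hΩc : Continuous Ω := hΩ.continuous
  -- the clamped level `C`, as a continuous function of `x = (k, E)`
  let C : (ℝ × ℝ) × ℝ → ℝ := fun x => max (Ω (a₁, P x.1)) (min x.2 (Ω (b₁, P x.1)))
  have hCc : Continuous C := by fun_prop
  have hCx : ∀ x : (ℝ × ℝ) × ℝ, Ω (h x.1 x.2, P x.1) = C x := fun x => (hh x.1 x.2).2
  refine continuous_iff_continuousAt.2 fun x₀ => ?_
  -- a continuous majorant `B` of `|h x - h x₀|`, vanishing at `x₀`
  let B : (ℝ × ℝ) × ℝ → ℝ := fun x =>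
    c⁻¹ * (|C x - C x₀| + |Ω (h x₀.1 x₀.2, P x₀.1) - Ω (h x₀.1 x₀.2, P x.1)|)
  have hBc : Continuous B := by fun_prop
  have hB0 : B x₀ = 0 := by
    show c⁻¹ * (|C x₀ - C x₀| + |Ω (h x₀.1 x₀.2, P x₀.1) - Ω (h x₀.1 x₀.2, P x₀.1)|) = 0
    simp
  rw [ContinuousAt, tendsto_iff_norm_sub_tendsto_zero]
  refine squeeze_zero (fun x => norm_nonneg _) (fun x => ?_) (hB0 ▸ hBc.tendsto x₀)
  have key : c * |h x.1 x.2 - h x₀.1 x₀.2| ≤ |C x - Ω (h x₀.1 x₀.2, P x.1)| := by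
    have := monoFibre_mul_abs_sub_le hΩ hd (hP x.1) (hh x₀.1 x₀.2).1 (hh x.1 x.2).1
    rwa [hCx x] at this
  have tri : |C x - Ω (h x₀.1 x₀.2, P x.1)| ≤
      |C x - C x₀| + |Ω (h x₀.1 x₀.2, P x₀.1) - Ω (h x₀.1 x₀.2, P x.1)| := by
    rw [← hCx x₀]
    exact abs_sub_le _ _ _
  rw [Real.norm_eq_abs]
  calc |h x.1 x.2 - h x₀.1 x₀.2| = c⁻¹ * (c * |h x.1 x.2 - h x₀.1 x₀.2|) := by
        rw [← mul_assoc, inv_mul_cancel₀ hc.ne', one_mul]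
    _ ≤ B x := mul_le_mul_of_nonneg_left (key.trans tri) (inv_nonneg.2 hc.le)

/-! ### The fibre density `Φ k E = G (h k E, k) / ∂₁Ω (h k E, P k)` -/

/-- The fibre density is non-negative. [folklore] -/
theorem monoFibre_dens_nonneg
    (hd : ∀ p ∈ Icc a₁ b₁ ×ˢ (Icc a₂ b₂ ×ˢ Icc a₃ b₃), c ≤ fderiv ℝ Ω p (1, 0, 0)) (hc : 0 < c)
    (hP : ∀ k, P k ∈ Icc a₂ b₂ ×ˢ Icc a₃ b₃)
    (hh : ∀ k E, h k E ∈ Icc a₁ b₁ ∧ Ω (h k E, P k) = max (Ω (a₁, P k)) (min E (Ω (b₁, P k))))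
    (hG0 : ∀ p, 0 ≤ G p) (hΦ : ∀ k E, Φ k E = G (h k E, k) / fderiv ℝ Ω (h k E, P k) (1, 0, 0))
    (k : ℝ × ℝ) (E : ℝ) : 0 ≤ Φ k E :=
  (hΦ k E).symm ▸ div_nonneg (hG0 _) (hc.le.trans (hd _ ⟨(hh k E).1, hP k⟩))

/-- The fibre density vanishes when the transversal parameter is outside the open transversal
box. [folklore] -/
theorem monoFibre_dens_eq_zero (hGs : tsupport G ⊆ Ioo a₁ b₁ ×ˢ (Ioo a₂ b₂ ×ˢ Ioo a₃ b₃))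
    (hΦ : ∀ k E, Φ k E = G (h k E, k) / fderiv ℝ Ω (h k E, P k) (1, 0, 0)) {k : ℝ × ℝ}
    (hk : k ∉ Ioo a₂ b₂ ×ˢ Ioo a₃ b₃) (E : ℝ) : Φ k E = 0 := by
  rw [hΦ, monoFibre_eq_zero_of_notMem hGs (p := (h k E, k)) (fun h' => hk h'.2), zero_div]

/-- Off the open fibre range the fibre density vanishes: if `Φ k E ≠ 0` then `E = Ω (t, P k)` for
some `t ∈ (a₁, b₁)`. [folklore] -/
theorem monoFibre_mem_image_of_dens_ne_zero (hΩ : ContDiff ℝ 1 Ω)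
    (hd : ∀ p ∈ Icc a₁ b₁ ×ˢ (Icc a₂ b₂ ×ˢ Icc a₃ b₃), c ≤ fderiv ℝ Ω p (1, 0, 0)) (hc : 0 < c)
    (hP : ∀ k, P k ∈ Icc a₂ b₂ ×ˢ Icc a₃ b₃)
    (hh : ∀ k E, h k E ∈ Icc a₁ b₁ ∧ Ω (h k E, P k) = max (Ω (a₁, P k)) (min E (Ω (b₁, P k))))
    (hGs : tsupport G ⊆ Ioo a₁ b₁ ×ˢ (Ioo a₂ b₂ ×ˢ Ioo a₃ b₃))
    (hΦ : ∀ k E, Φ k E = G (h k E, k) / fderiv ℝ Ω (h k E, P k) (1, 0, 0)) {k : ℝ × ℝ} {E : ℝ}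
    (hne : Φ k E ≠ 0) : E ∈ (fun t => Ω (t, P k)) '' Ioo a₁ b₁ := by
  obtain ⟨hm, he⟩ := hh k E
  have hIoo : h k E ∈ Ioo a₁ b₁ := by
    by_contra H
    exact hne (by rw [hΦ, monoFibre_eq_zero_of_notMem hGs (fun h' => H h'.1), zero_div])
  -- strict monotonicity puts the clamped level strictly inside the fibre range, so it equals `E`
  have hlo := (mul_pos hc (sub_pos.2 hIoo.1)).trans_le
    (monoFibre_mul_sub_le hΩ hd (hP k) (left_mem_Icc.2 (hm.1.trans hm.2)) hm hIoo.1.le)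
  have hhi := (mul_pos hc (sub_pos.2 hIoo.2)).trans_le
    (monoFibre_mul_sub_le hΩ hd (hP k) hm (right_mem_Icc.2 (hm.1.trans hm.2)) hIoo.2.le)
  rw [he, sub_pos, lt_max_iff, lt_min_iff] at hlo
  rw [he, sub_pos, max_lt_iff, min_lt_iff] at hhi
  refine ⟨h k E, hIoo, ?_⟩
  show Ω (h k E, P k) = E
  rw [he, min_eq_left (hhi.2.resolve_right (lt_irrefl _)).le,
    max_eq_right (hlo.resolve_left (lt_irrefl _)).1.le]

/-- Joint continuity of the fibre density. [folklore] -/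
theorem monoFibre_continuous_dens (hΩ : ContDiff ℝ 1 Ω)
    (hd : ∀ p ∈ Icc a₁ b₁ ×ˢ (Icc a₂ b₂ ×ˢ Icc a₃ b₃), c ≤ fderiv ℝ Ω p (1, 0, 0)) (hc : 0 < c)
    (hP : ∀ k, P k ∈ Icc a₂ b₂ ×ˢ Icc a₃ b₃) (hPc : Continuous P)
    (hh : ∀ k E, h k E ∈ Icc a₁ b₁ ∧ Ω (h k E, P k) = max (Ω (a₁, P k)) (min E (Ω (b₁, P k))))
    (hGc : Continuous G) (hΦ : ∀ k E, Φ k E = G (h k E, k) / fderiv ℝ Ω (h k E, P k) (1, 0, 0)) :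
    Continuous fun x : (ℝ × ℝ) × ℝ => Φ x.1 x.2 := by
  have hhc := monoFibre_continuous_inv hΩ hd hc hP hPc hh
  simp only [hΦ]
  refine Continuous.div (hGc.comp (hhc.prodMk continuous_fst)) ?_
    fun x => (hc.trans_le (hd _ ⟨(hh x.1 x.2).1, hP x.1⟩)).ne'
  exact ((hΩ.continuous_fderiv one_ne_zero).comp
    (hhc.prodMk (hPc.comp continuous_fst))).clm_apply continuous_const

/-- The level density `ρ E = ∫ k in Q, Φ k E` is continuous (parametric integral of a jointly
continuous integrand over a compact set). [folklore] -/
theorem monoFibre_continuous_rho (hΩ : ContDiff ℝ 1 Ω)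
    (hd : ∀ p ∈ Icc a₁ b₁ ×ˢ (Icc a₂ b₂ ×ˢ Icc a₃ b₃), c ≤ fderiv ℝ Ω p (1, 0, 0)) (hc : 0 < c)
    (hP : ∀ k, P k ∈ Icc a₂ b₂ ×ˢ Icc a₃ b₃) (hPc : Continuous P)
    (hh : ∀ k E, h k E ∈ Icc a₁ b₁ ∧ Ω (h k E, P k) = max (Ω (a₁, P k)) (min E (Ω (b₁, P k))))
    (hGc : Continuous G) (hΦ : ∀ k E, Φ k E = G (h k E, k) / fderiv ℝ Ω (h k E, P k) (1, 0, 0)) :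
    Continuous fun E => ∫ k in Icc a₂ b₂ ×ˢ Icc a₃ b₃, Φ k E := by
  have hu : Continuous (uncurry fun (E : ℝ) (k : ℝ × ℝ) => Φ k E) :=
    (monoFibre_continuous_dens hΩ hd hc hP hPc hh hGc hΦ).comp continuous_swap
  exact continuous_parametric_integral_of_continuous hu (isCompact_Icc.prod isCompact_Icc)

/-- `ofReal (ρ E) = ∫⁻ k, ofReal (Φ k E)` over the whole transversal plane. [folklore] -/
theorem monoFibre_ofReal_rho (hΩ : ContDiff ℝ 1 Ω)
    (hd : ∀ p ∈ Icc a₁ b₁ ×ˢ (Icc a₂ b₂ ×ˢ Icc a₃ b₃), c ≤ fderiv ℝ Ω p (1, 0, 0)) (hc : 0 < c)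
    (hP : ∀ k, P k ∈ Icc a₂ b₂ ×ˢ Icc a₃ b₃) (hPc : Continuous P)
    (hh : ∀ k E, h k E ∈ Icc a₁ b₁ ∧ Ω (h k E, P k) = max (Ω (a₁, P k)) (min E (Ω (b₁, P k))))
    (hGc : Continuous G) (hG0 : ∀ p, 0 ≤ G p)
    (hGs : tsupport G ⊆ Ioo a₁ b₁ ×ˢ (Ioo a₂ b₂ ×ˢ Ioo a₃ b₃))
    (hΦ : ∀ k E, Φ k E = G (h k E, k) / fderiv ℝ Ω (h k E, P k) (1, 0, 0)) (E : ℝ) :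
    ENNReal.ofReal (∫ k in Icc a₂ b₂ ×ˢ Icc a₃ b₃, Φ k E) = ∫⁻ k, ENNReal.ofReal (Φ k E) := by
  have hcont : Continuous fun k => Φ k E :=
    (monoFibre_continuous_dens hΩ hd hc hP hPc hh hGc hΦ).comp
      (continuous_id.prodMk continuous_const)
  rw [ofReal_integral_eq_lintegral_ofReal
    (hcont.continuousOn.integrableOn_compact (isCompact_Icc.prod isCompact_Icc))
    (Eventually.of_forall fun k => monoFibre_dens_nonneg hd hc hP hh hG0 hΦ k E)]
  refine setLIntegral_eq_of_support_subset fun k hk => ?_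
  by_contra hkB
  have hk' : k ∉ Ioo a₂ b₂ ×ˢ Ioo a₃ b₃ := fun H =>
    hkB ⟨Ioo_subset_Icc_self H.1, Ioo_subset_Icc_self H.2⟩
  exact hk (by simp [monoFibre_dens_eq_zero hGs hΦ hk' E])

/-! ### The fibre identity (1-D change of variables) and the main theorem -/

/-- On each fibre, `∫ G(t,k) f(Ω(t,k)) dt = ∫ Φ k E · f E dE` for every `f : ℝ → ℝ≥0∞`
(here the clamp `P` must be the identity on the transversal box). [folklore] -/
theorem monoFibre_fibre_lintegral (hΩ : ContDiff ℝ 1 Ω)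
    (hd : ∀ p ∈ Icc a₁ b₁ ×ˢ (Icc a₂ b₂ ×ˢ Icc a₃ b₃), c ≤ fderiv ℝ Ω p (1, 0, 0)) (hc : 0 < c)
    (hP : ∀ k, P k ∈ Icc a₂ b₂ ×ˢ Icc a₃ b₃) (hPid : ∀ k ∈ Icc a₂ b₂ ×ˢ Icc a₃ b₃, P k = k)
    (hh : ∀ k E, h k E ∈ Icc a₁ b₁ ∧ Ω (h k E, P k) = max (Ω (a₁, P k)) (min E (Ω (b₁, P k))))
    (hGs : tsupport G ⊆ Ioo a₁ b₁ ×ˢ (Ioo a₂ b₂ ×ˢ Ioo a₃ b₃))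
    (hΦ : ∀ k E, Φ k E = G (h k E, k) / fderiv ℝ Ω (h k E, P k) (1, 0, 0)) (f : ℝ → ℝ≥0∞)
    (k : ℝ × ℝ) :
    ∫⁻ t, ENNReal.ofReal (G (t, k)) * f (Ω (t, k)) = ∫⁻ E, ENNReal.ofReal (Φ k E) * f E := by
  by_cases hk : k ∈ Ioo a₂ b₂ ×ˢ Ioo a₃ b₃
  swap
  · have h0 : ∀ t, G (t, k) = 0 := fun t => monoFibre_eq_zero_of_notMem hGs (fun H => hk H.2)
    simp [h0, monoFibre_dens_eq_zero hGs hΦ hk]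
  have hkB : k ∈ Icc a₂ b₂ ×ˢ Icc a₃ b₃ := ⟨Ioo_subset_Icc_self hk.1, Ioo_subset_Icc_self hk.2⟩
  have hL : (support fun t => ENNReal.ofReal (G (t, k)) * f (Ω (t, k))) ⊆ Ioo a₁ b₁ := by
    intro t ht
    by_contra hts
    exact ht (by simp [monoFibre_eq_zero_of_notMem hGs (p := (t, k)) (fun H => hts H.1)])
  have hR : (support fun E => ENNReal.ofReal (Φ k E) * f E) ⊆ (fun t => Ω (t, k)) '' Ioo a₁ b₁ := by
    intro E hE
    have hne : Φ k E ≠ 0 := fun H => hE (by simp [H])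
    simpa only [hPid k hkB] using monoFibre_mem_image_of_dens_ne_zero hΩ hd hc hP hh hGs hΦ hne
  rw [← setLIntegral_eq_of_support_subset hL, ← setLIntegral_eq_of_support_subset hR,
    lintegral_image_eq_lintegral_abs_deriv_mul measurableSet_Ioo
      (fun t _ => (monoFibre_hasDerivAt hΩ k t).hasDerivWithinAt)
      ((monoFibre_injOn hΩ hd hc hkB).mono Ioo_subset_Icc_self)]
  refine setLIntegral_congr_fun measurableSet_Ioo (fun t ht => ?_)
  have hdpos : 0 < fderiv ℝ Ω (t, k) (1, 0, 0) := hc.trans_le (hd _ ⟨Ioo_subset_Icc_self ht, hkB⟩)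
  have hΦt : Φ k (Ω (t, k)) = G (t, k) / fderiv ℝ Ω (t, k) (1, 0, 0) := by
    have := monoFibre_inv_apply hΩ hd hc hP hh k (Ioo_subset_Icc_self ht)
    rw [hPid k hkB] at this
    rw [hΦ, this, hPid k hkB]
  show ENNReal.ofReal (G (t, k)) * f (Ω (t, k)) = ENNReal.ofReal |fderiv ℝ Ω (t, k) (1, 0, 0)| *
    (ENNReal.ofReal (Φ k (Ω (t, k))) * f (Ω (t, k)))
  rw [hΦt, ← mul_assoc, abs_of_pos hdpos, ← ENNReal.ofReal_mul hdpos.le,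
    mul_div_cancel₀ _ hdpos.ne']

/-- **Monotone fibre density** (stub REG-loc of line `swap-odd-threshold-rigidity`): if
`∂₁Ω ≥ c > 0` on a closed box and `G ≥ 0` is continuous with topological support in the open box,
the push-forward `Ω_*(G · vol)` has a continuous non-negative density on `ℝ`. [folklore] -/
theorem stub_monotoneFibreDensity :
    ∀ (Ω G : ℝ × ℝ × ℝ → ℝ) (a₁ b₁ a₂ b₂ a₃ b₃ c : ℝ), 0 < c → ContDiff ℝ 1 Ω → Continuous G →
      (∀ p, 0 ≤ G p) →
      tsupport G ⊆ Set.Ioo a₁ b₁ ×ˢ (Set.Ioo a₂ b₂ ×ˢ Set.Ioo a₃ b₃) →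
      (∀ p ∈ Set.Icc a₁ b₁ ×ˢ (Set.Icc a₂ b₂ ×ˢ Set.Icc a₃ b₃), c ≤ fderiv ℝ Ω p (1, 0, 0)) →
      ∃ ρ : ℝ → ℝ, Continuous ρ ∧ (∀ x, 0 ≤ ρ x) ∧
        MeasureTheory.Measure.map Ω (volume.withDensity fun p => ENNReal.ofReal (G p)) =
          volume.withDensity fun x => ENNReal.ofReal (ρ x) := by
  intro Ω G a₁ b₁ a₂ b₂ a₃ b₃ c hc hΩ hGc hG0 hGs hd
  by_cases hbox : a₁ ≤ b₁ ∧ a₂ ≤ b₂ ∧ a₃ ≤ b₃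
  swap
  · -- degenerate box: the open box is empty, so `G = 0` and `ρ = 0` works
    have hG : ∀ p, G p = 0 := fun p => monoFibre_eq_zero_of_notMem hGs fun ⟨hp1, hp2, hp3⟩ =>
      hbox ⟨(hp1.1.trans hp1.2).le, (hp2.1.trans hp2.2).le, (hp3.1.trans hp3.2).le⟩
    refine ⟨fun _ => 0, continuous_const, fun _ => le_rfl, ?_⟩
    have h0 : (fun p => ENNReal.ofReal (G p)) = 0 := by funext p; simp [hG]
    have h0' : (fun _ : ℝ => ENNReal.ofReal (0 : ℝ)) = 0 := by funext; simp
    show Measure.map Ω (volume.withDensity fun p => ENNReal.ofReal (G p)) =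
      volume.withDensity fun _ => ENNReal.ofReal 0
    rw [h0, h0', withDensity_zero, withDensity_zero, Measure.map_zero]
  obtain ⟨h₁, h₂, h₃⟩ := hbox
  -- the clamp `P` onto the transversal box, a clamped inverse `h`, the fibre density `Φ`
  obtain ⟨P, hPdef⟩ :
      ∃ P : ℝ × ℝ → ℝ × ℝ, P = fun k => (max a₂ (min k.1 b₂), max a₃ (min k.2 b₃)) := ⟨_, rfl⟩
  have hP : ∀ k, P k ∈ Icc a₂ b₂ ×ˢ Icc a₃ b₃ := fun k => hPdef ▸
    ⟨⟨le_max_left _ _, max_le h₂ (min_le_right _ _)⟩,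
      ⟨le_max_left _ _, max_le h₃ (min_le_right _ _)⟩⟩
  have hPc : Continuous P :=
    hPdef ▸ (continuous_const.max (continuous_fst.min continuous_const)).prodMk
      (continuous_const.max (continuous_snd.min continuous_const))
  have hPid : ∀ k ∈ Icc a₂ b₂ ×ˢ Icc a₃ b₃, P k = k := fun k ⟨⟨hk1, hk2⟩, ⟨hk3, hk4⟩⟩ => by
    simp [hPdef, min_eq_left hk2, min_eq_left hk4, max_eq_right hk1, max_eq_right hk3]
  obtain ⟨h, hh⟩ := monoFibre_exists_inv hΩ hd hc h₁ hP
  obtain ⟨Φ, hΦ⟩ : ∃ Φ : ℝ × ℝ → ℝ → ℝ,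
      ∀ k E, Φ k E = G (h k E, k) / fderiv ℝ Ω (h k E, P k) (1, 0, 0) := ⟨_, fun _ _ => rfl⟩
  have hρc := monoFibre_continuous_rho hΩ hd hc hP hPc hh hGc hΦ
  refine ⟨fun E => ∫ k in Icc a₂ b₂ ×ˢ Icc a₃ b₃, Φ k E, hρc,
    fun E => integral_nonneg fun k => monoFibre_dens_nonneg hd hc hP hh hG0 hΦ k E, ?_⟩
  have hΩm : Measurable Ω := hΩ.continuous.measurable
  have hGm : Measurable fun p => ENNReal.ofReal (G p) := hGc.measurable.ennreal_ofReal
  have hΦc := monoFibre_continuous_dens hΩ hd hc hP hPc hh hGc hΦ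
  refine Measure.ext_of_lintegral _ fun f hf => ?_
  have hfΩ : Measurable fun p => f (Ω p) := hf.comp hΩm
  rw [lintegral_withDensity_eq_lintegral_mul _ hρc.measurable.ennreal_ofReal hf,
    lintegral_map hf hΩm, lintegral_withDensity_eq_lintegral_mul _ hGm hfΩ]
  simp only [Pi.mul_apply]
  have hΦf : AEMeasurable (uncurry fun (k : ℝ × ℝ) (E : ℝ) => ENNReal.ofReal (Φ k E) * f E)
      (volume.prod volume) :=
    (hΦc.measurable.ennreal_ofReal.mul (hf.comp measurable_snd)).aemeasurable
  calc ∫⁻ p, ENNReal.ofReal (G p) * f (Ω p)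
      = ∫⁻ k : ℝ × ℝ, ∫⁻ t : ℝ, ENNReal.ofReal (G (t, k)) * f (Ω (t, k)) := by
        rw [Measure.volume_eq_prod]
        exact lintegral_prod_symm _ (hGm.mul hfΩ).aemeasurable
    _ = ∫⁻ k : ℝ × ℝ, ∫⁻ E : ℝ, ENNReal.ofReal (Φ k E) * f E :=
        lintegral_congr fun k => monoFibre_fibre_lintegral hΩ hd hc hP hPid hh hGs hΦ f k
    _ = ∫⁻ E : ℝ, ∫⁻ k : ℝ × ℝ, ENNReal.ofReal (Φ k E) * f E := lintegral_lintegral_swap hΦf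
    _ = ∫⁻ E, ENNReal.ofReal (∫ k in Icc a₂ b₂ ×ˢ Icc a₃ b₃, Φ k E) * f E := by
        refine lintegral_congr fun E => ?_
        have hΦE : Measurable fun k => ENNReal.ofReal (Φ k E) :=
          (hΦc.comp (continuous_id.prodMk continuous_const)).measurable.ennreal_ofReal
        rw [lintegral_mul_const _ hΦE, monoFibre_ofReal_rho hΩ hd hc hP hPc hh hGc hG0 hGs hΦ E]

end Summit.AtomisticToContinuum.FouriersLaw.Theorems.MourreDissolution
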